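import Literature.AlgebraicGeometry.Motives.HodgeLieRigidityTraceCriterion
import HarnessLib

/-!
# `Θ`-rigidity for Hodge structures whose Hodge Lie algebra has centre of rank `≤ 1`: one Hodge endomorphism `c` with `tr(c_ℂ Θ) ≠ 0` suffices
# (rigidity modulo the centre; the trace form pairs `End_Hdg` trivially with `[𝔥, 𝔥]`)

Family `hodge`, layer `Literature/AlgebraicGeometry/Motives`.  THEOREMS ONLY (no definition, no named fact).  Written for the
cell `pub-hodgecm2` (COR-CM), seat `b27` gen 54 (count-neutral Mumford–Tate-rank ladder, «rigidity modulo the centre», part 6).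

`H` polarized, `𝔥 = Lie Hg(H) = 𝔷 ⊕ 𝔡`.  If `dim 𝔷 ≤ 1`, a `Θ`-subalgebra `𝔞 ⊆ 𝔥` (which contains `𝔡`, part 3) either contains `𝔷` — and then
`𝔞 = 𝔥` — or equals `𝔡`; in the latter case `Θ ∈ 𝔡 ⊗ ℂ`, so `tr(c_ℂ Θ) = 0` for EVERY Hodge endomorphism `c` (`c` commutes with `𝔥`, hence
`tr(c [X,Y]) = 0`).  Hence:
* **`rigid_of_finrank_center_le_one`** — `dim (𝔥 ∩ End_Hdg) ≤ 1` and `tr(c_ℂ Θ) ≠ 0` for SOME `c ∈ End_Hdg(H)` ⟹ `H` is `Θ`-rigid.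
  (For `H¹` of an abelian variety with a type-IV factor of unbalanced multiplicities `(n′, n″)`, `c = φ^*` has `tr(c_ℂ Θ) = 2i√d(n′ − n″) ≠ 0`.)
* `trace_baseChange_mul_theta_eq_zero_of_mem_endAlg_of_theta_mem_derived` — the vanishing used.

## References
* [Deligne1982HodgeCycles] P. Deligne, LNM 900 (1982), I §3 Prop. 3.6. [cite: Deligne1982HodgeCycles, I §3 Prop. 3.6]
* [MoonenZarhin1999LowDim] B. Moonen, Yu. G. Zarhin, Math. Ann. 315 (1999), §3 (3.1) [corpus: paper:arxiv-math_9901113 p. 6].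
  [cite: MoonenZarhin1999LowDim, §3 (3.1)]
* [Gordon1997] B. B. Gordon, *A survey of the Hodge conjecture for abelian varieties*, 1.13.2. [cite: Gordon1997, 1.13.2]
-/

noncomputable section

open scoped TensorProduct

namespace Literature.AlgebraicGeometry.Motives

namespace HodgeStructure

universe u

variable {V : Type u} [AddCommGroup V] [Module ℚ V] [Module.Finite ℚ V] [HodgeTensorFacts.{u, u}] {n : ℤ}

/-- **A Hodge endomorphism is trace-orthogonal to `[𝔥,𝔥] ⊗ ℂ`**: if `Θ` lies in the complex span of `𝔡 = [𝔥(H), 𝔥(H)]` then `tr(c_ℂ Θ) = 0`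
for every `c ∈ End_Hdg(H)` (`c` commutes with `𝔥`, `tr(c(XY − YX)) = 0`). [cite: Deligne1982HodgeCycles, I §3 Prop. 3.6] -/
theorem trace_baseChange_mul_eq_zero_of_mem_endAlg_of_mem_spanC_derived (H : HodgeStructure V n) {c : Module.End ℚ V}
    (hc : c ∈ H.endAlg) {Y : Module.End ℂ (ℂ ⊗[ℚ] V)}
    (hY : Y ∈ Submodule.span ℂ ((fun X : Module.End ℚ V => X.baseChange ℂ) ''
      ((Submodule.span ℚ {B | ∃ X ∈ H.hodgeLie, ∃ Y ∈ H.hodgeLie, X * Y - Y * X = B} : Submodule ℚ (Module.End ℚ V)) :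
        Set (Module.End ℚ V)))) :
    LinearMap.trace ℂ (ℂ ⊗[ℚ] V) (c.baseChange ℂ * Y) = 0 := by
  have hcc : ∀ X ∈ H.hodgeLie, c * X = X * c := fun X hX => (H.commute_of_mem_hodgeLie hX ⟨c, hc⟩).symm
  exact trace_baseChange_mul_eq_zero_of_mem_spanC _
    (fun B hB => Literature.Algebra.Lie.TraceSeparating.trace_mul_eq_zero_of_central_of_mem_derived H.hodgeLie hcc hB) hY

/-- **`Θ`-rigidity when the centre of `𝔥(H)` has rank `≤ 1`**: if `dim_ℚ (𝔥(H) ∩ End_Hdg(H)) ≤ 1` and some Hodge endomorphism `c` has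
`tr(c_ℂ ∘ Θ) ≠ 0`, then every bracket-closed rational `𝔞 ⊆ 𝔥(H)` whose complex span contains a Hodge operator is `𝔥(H)`.
[cite: MoonenZarhin1999LowDim, §3 (3.1)] [cite: Deligne1982HodgeCycles, I §3 Prop. 3.6] [cite: Gordon1997, 1.13.2] -/
theorem rigid_of_finrank_center_le_one (H : HodgeStructure V n) (hH : H.IsPolarizable) {Θ₀ : Module.End ℂ (ℂ ⊗[ℚ] V)}
    (hΘ₀ : ∀ p, ∀ x ∈ H.piece p (n - p), Θ₀ x = ((2 * p - n : ℤ) : ℂ) • x)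
    (h𝔷 : Module.finrank ℚ ↥(H.hodgeLie ⊓ Subalgebra.toSubmodule H.endAlg) ≤ 1)
    {c : Module.End ℚ V} (hc : c ∈ H.endAlg) (hcΘ : LinearMap.trace ℂ (ℂ ⊗[ℚ] V) (c.baseChange ℂ * Θ₀) ≠ 0) :
    ∀ 𝔞 : Submodule ℚ (Module.End ℚ V), 𝔞 ≤ H.hodgeLie →
      (∀ X ∈ 𝔞, ∀ Y ∈ 𝔞, X * Y - Y * X ∈ 𝔞) →
      (∃ Θ ∈ Submodule.span ℂ ((fun X : Module.End ℚ V => X.baseChange ℂ) '' (𝔞 : Set (Module.End ℚ V))),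
        ∀ p, ∀ x ∈ H.piece p (n - p), Θ x = ((2 * p - n : ℤ) : ℂ) • x) → H.hodgeLie ≤ 𝔞 := by
  classical
  obtain ⟨ψ⟩ := hH
  intro 𝔞 h𝔞 hbr hΘ
  obtain ⟨Θ, hΘmem, hΘp⟩ := hΘ
  have hΘeq : Θ = Θ₀ := linearMap_ext_of_piece H fun p x hx => by rw [hΘp p x hx, hΘ₀ p x hx]
  set 𝔷 := H.hodgeLie ⊓ Subalgebra.toSubmodule H.endAlg with h𝔷def
  set 𝔡 := Submodule.span ℚ {B | ∃ X ∈ H.hodgeLie, ∃ Y ∈ H.hodgeLie, X * Y - Y * X = B} with h𝔡def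
  have h𝔡𝔞 : 𝔡 ≤ 𝔞 := derived_le_of_theta_mem H ψ 𝔞 h𝔞 hbr ⟨Θ, hΘmem, hΘp⟩
  refine hodgeLie_le_of_theta_mem_of_center_le H ψ 𝔞 h𝔞 hbr ⟨Θ, hΘmem, hΘp⟩ ?_
  by_contra h𝔷𝔞
  -- `𝔷` is a line `ℚ z₀` missing `𝔞`, so `𝔞 = 𝔡`
  obtain ⟨z₀, hz₀𝔷', hz₀𝔞⟩ := Set.not_subset.1 h𝔷𝔞
  have hz₀𝔷 : z₀ ∈ 𝔷 := hz₀𝔷'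
  have hz₀0 : z₀ ≠ 0 := fun h => hz₀𝔞 (by rw [h]; exact 𝔞.zero_mem)
  have hline : ∀ z ∈ 𝔷, ∃ q : ℚ, z = q • z₀ := by
    intro z hz
    have h1 : Module.finrank ℚ ↥𝔷 = 1 := by
      refine le_antisymm h𝔷 ?_
      rw [Nat.one_le_iff_ne_zero]
      intro h0
      rw [Submodule.finrank_eq_zero] at h0
      rw [h0, Submodule.mem_bot] at hz₀𝔷
      exact hz₀0 hz₀𝔷
    obtain ⟨q, hq⟩ := (finrank_eq_one_iff_of_nonzero' (⟨z₀, hz₀𝔷⟩ : ↥𝔷) (fun h => hz₀0 (congrArg Subtype.val h))).1 h1 ⟨z, hz⟩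
    exact ⟨q, by simpa using (congrArg Subtype.val hq).symm⟩
  have h𝔞𝔡 : 𝔞 ≤ 𝔡 := by
    intro A hA
    have hA𝔥 : A ∈ 𝔷 ⊔ 𝔡 := by rw [h𝔷def, AnyWeight.hodgeLie_center_sup_derived_eq H ψ]; exact h𝔞 hA
    obtain ⟨z, hz, d, hd, rfl⟩ := Submodule.mem_sup.1 hA𝔥
    obtain ⟨q, rfl⟩ := hline z hz
    have hqz : q • z₀ ∈ 𝔞 := by
      have h := 𝔞.sub_mem hA (h𝔡𝔞 hd)
      rwa [add_sub_cancel_right] at h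
    by_cases hq : q = 0
    · rw [hq, zero_smul, zero_add]; exact hd
    · exact absurd (by simpa [hq] using 𝔞.smul_mem q⁻¹ hqz) hz₀𝔞
  -- then `Θ ∈ 𝔡 ⊗ ℂ` and `tr(c_ℂ Θ) = 0`
  have hΘ𝔡 : Θ ∈ Submodule.span ℂ ((fun X : Module.End ℚ V => X.baseChange ℂ) '' (𝔡 : Set (Module.End ℚ V))) :=
    Submodule.span_mono (Set.image_mono fun x hx => h𝔞𝔡 hx) hΘmem
  have h0 := trace_baseChange_mul_eq_zero_of_mem_endAlg_of_mem_spanC_derived H hc hΘ𝔡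
  rw [hΘeq] at h0
  exact hcΘ h0

end HodgeStructure

end Literature.AlgebraicGeometry.Motives

end
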